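import Summits.Ventures.PercRepro.RankLevelSetExplicitLin2KeyCube

/-!
# PercRepro — THE LEVEL-12 CUBE ROW OF C-025: THE KEY AT `p = 14 173` AND THE CONDITIONAL LEVEL STEP (p9, S4)

`proofs/SUBCLAIM-S4-p9.md` §S4.2⁗‴. The saturated row of record at level `12` is `p ≥ 40 204` (RankLevelSetExplicitLin2RowTwelve).
With p4's cube multiplicity the assembled inequality `(P_d)` holds, exactly evaluated, at EVERY core corank `13 ≤ d ≤ 4108`
from `p = 14 173` — and fails at `p = 14 172` (corank `2 547`, the big class's saturation corank):
the cube key `KeyC 12 14173 d` (RankLevelSetExplicitLin2KeyCube) is checked by the kernel at the 4 096 coranks (`decide`, 1 chunk of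
4 096), and `c025_level_succ_of_keyC_row` turns the row into the level step
**`c025_twelve_cube_step (hprev : ∀ M p, 14 172 ≤ p → RLS M p 11) : ∀ M p, 14 173 ≤ p → RLS M p 12`** (`N₁(12) = 8 532`,
tail `8 257`). The unconditional rows are composed in RankLevelSetExplicitLin2CubeFloor. Axioms: standard.
-/

open scoped Matroid

namespace PercRepro

namespace ThmN

namespace Explicit

/-- **THE CUBE KEY ROW AT `(q, p) = (12, 14 173)`**: `KeyC 12 14173 d` at every corank `13 ≤ d ≤ 4108`, by the kernel. -/
theorem key_twelve_cube_row : ∀ t < 4096, KeyC 12 14173 (13 + t) := by decide +kernel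

/-- **THE CUBE FLOOR IS EXACT**: the cube key FAILS at `p = 14 172`, corank `2 547` (the big class's saturation corank), by the kernel. -/
theorem key_twelve_cube_sharp : ¬ KeyC 12 14172 2547 := by decide +kernel

end Explicit

variable {α : Type}

/-- **THE LEVEL-12 CUBE STEP FROM `14 173`**: level `12` for every finite matroid and every `p ≥ 14 173` from level `11` for
every `p ≥ 14 172` — the cube key row at `14 173`, its monotonicity in `p`, and the wrapper `c025_level_succ_of_keyC_row`
(`N₁(12) = 8 532 ≤ 14 173`, tail `8 257 ≤ 14 173`). -/
theorem c025_twelve_cube_step (hprev : ∀ (M : Matroid α) [M.Finite] (p : ℕ), 14172 ≤ p → RLS M p 11) :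
    ∀ (M : Matroid α) [M.Finite] (p : ℕ), 14173 ≤ p → RLS M p 12 :=
  c025_level_succ_of_keyC_row 11 (by norm_num) 14173 (by norm_num) (by norm_num) Explicit.key_twelve_cube_row hprev

end ThmN

end PercRepro
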